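import Summits.HodgeConjecture.HodgeConjecture.Theses.TropicalWeilObstruction
import Summits.HodgeConjecture.HodgeConjecture.Theorems.TropicalWeilObstructionTropicalHodgeBoundWeilPairing
import Literature.Geometry.Kaehler.ComplexTorusHodgeGroupCompactRealForm
import Mathlib.Analysis.Matrix.PosDef
import HarnessLib

/-!
# Crux `TropicalHodgeBound` / `TropicalWeilVanishing` (route `TropicalWeilObstruction`): the hermitian
# pairing `dz ⊗ dz̄` on the three tropical `(n,n)`-classes, and the values of `Ŵ` on the Weil classes

Route `HodgeConjecture/TropicalWeilObstruction` is a REFUTATION route (Kontsevich's tropical test, negative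
branch); this is negation-sink bookkeeping of the cell `pub-hodge-tropical` (seat tropical-2). Helper file for
`TropicalWeilObstructionTropicalWeilVanishingCalibrationCone.lean` (the calibration cone of effective tropical
`4`-cycle classes, K1 scope); linear algebra over `ℂ` in general dimension `n`, on top of the landed K3 helper
files (`…FramePairing`, `…WeilPairing`). Nothing here is a statement about the Hodge conjecture or about the
open crux K1.

With `P = [1 | i·1]` (`dz = det P[·,S]`), `Ω = Pᴴ`, `θ_n(Q)(S,S') = det Q[S,S']`, `w(Q) = (⋀ⁿQ ⊗ 1)(Ω ⊗ Ω)` as in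
the K3 skeleton (display-only notation, verbatim bodies; the NEW display-only notation `M̂(C) =
Σ_{S,S'} dz(S) conj(dz(S')) C(S,S') / (n!)²` is the hermitian pairing — nothing is defined):
* `hermPairing_cyc` — `M̂(cyc Z) = Σ_σ w_σ a_σ ‖η_σ‖²` (the "mass" `μ(Z)` of an effective tropical `n`-cycle);
* `hermPairing_thetaClass_eq_det` — `M̂(θ_n(Q)) = det (P Q Pᴴ)`;
* `hermPairing_weilClassRe_eq_zero`, `hermPairing_weilClassIm_eq_zero` — `M̂(Re w) = M̂(Im w) = 0` for `QJ = JQ`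
  (`P̄ Pᴴ = conj(P Pᵀ) = 0` kills `M̂_ℂ(w)`; `P Q Pᵀ = 0` kills `M̂_ℂ(w̄)`);
* `weilPairing_weilClassRe_eq`, `weilPairing_weilClassIm_eq` — `Ŵ(Re w) = 2ⁿ⁻¹ det (P Q Pᴴ)`,
  `Ŵ(Im w) = -i 2ⁿ⁻¹ det (P Q Pᴴ)` (from the landed `Ŵ_ℂ(w) = 2ⁿ det (P Q Pᴴ)`, `Ŵ_ℂ(w̄) = 0`);
* `det_frame_mul_map_mul_conjTranspose_pos` — `det (P Q Pᴴ)` is a positive real for `Q ≻ 0` (`P Q Pᴴ` is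
  positive definite hermitian: `posDef_map_ofRealHom` and `PosDef.mul_mul_conjTranspose_same`).

HONEST STATUS. Matrix identities only; no definition, no named fact, no sorry.
[cite: Zharkov2020TropicalWeil, §2] [cite: MikhalkinZharkov2014Eigenwave, Prop. 4.3]
-/

set_option linter.dupNamespace false

noncomputable section

open scoped BigOperators ComplexOrder
open Matrix
open Literature.AlgebraicGeometry.Tropical

namespace Summit.HodgeConjecture.HodgeConjecture.Theorems.TropicalHodgeBound

/-! ## §0 Display-only notation (the K3 skeleton's local definitions, verbatim bodies; nothing is defined) -/

/-- `P = [1 | i·1]`, the `n × 2n` matrix of `dz₁ ∧ … ∧ dz_n`. -/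
local notation3 (prettyPrint := false) "𝐏⟦" n "⟧" =>
  (Matrix.of fun (k : Fin n) (a : Fin (2 * n)) =>
    (if (a : ℕ) = (k : ℕ) then (1 : ℂ) else 0) + (if (a : ℕ) = (k : ℕ) + n then Complex.I else 0))

/-- The skeleton's `dzCoord n S`. -/
local notation3 (prettyPrint := false) "dz⟦" n "⟧" S:max =>
  (Matrix.det (Matrix.of fun k a : Fin n =>
    (if (S a : ℕ) = (k : ℕ) then (1 : ℂ) else 0) + (if (S a : ℕ) = (k : ℕ) + n then Complex.I else 0)))

/-- The skeleton's `weilPairing n C` (the value `Ŵ(C)` of `dz ⊗ dz`). -/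
local notation3 (prettyPrint := false) "Ŵ⟦" n "⟧" C:max =>
  (∑ S : Fin n → Fin (2 * n), ∑ S' : Fin n → Fin (2 * n),
    dz⟦n⟧ S * dz⟦n⟧ S' / ((Nat.factorial n : ℂ) ^ 2) * ((C S S' : ℝ) : ℂ))

/-- NEW display-only notation: the hermitian pairing `M̂(C)` (the value of `dz ⊗ dz̄` on `C`). -/
local notation3 (prettyPrint := false) "M̂⟦" n "⟧" C:max =>
  (∑ S : Fin n → Fin (2 * n), ∑ S' : Fin n → Fin (2 * n),
    dz⟦n⟧ S * (starRingEnd ℂ) (dz⟦n⟧ S') / ((Nat.factorial n : ℂ) ^ 2) * ((C S S' : ℝ) : ℂ))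

/-- The skeleton's `thetaClass n Q`. -/
local notation3 (prettyPrint := false) "θ⟦" n "⟧" Q:max =>
  (fun S S' : Fin n → Fin (2 * n) => Matrix.det (Matrix.submatrix Q S S'))

/-- The skeleton's `omegaFrame n` (`Ω = Pᴴ`). -/
local notation3 (prettyPrint := false) "Ω⟦" n "⟧" =>
  (Matrix.of fun (a : Fin (2 * n)) (b : Fin n) =>
    (if (a : ℕ) = (b : ℕ) then (1 : ℂ) else 0) - (if (a : ℕ) = (b : ℕ) + n then Complex.I else 0))

/-- The skeleton's `weilClassC n Q` (`w(Q) = (⋀ⁿQ ⊗ 1)(Ω ⊗ Ω)`). -/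
local notation3 (prettyPrint := false) "wC⟦" n "⟧" Q:max =>
  (fun S S' : Fin n → Fin (2 * n) =>
    Matrix.det (Matrix.submatrix (Matrix.map Q ((↑) : ℝ → ℂ) * Ω⟦n⟧) S id) *
      Matrix.det (Matrix.submatrix (Ω⟦n⟧) S' id))

/-- The skeleton's `weilClassRe n Q` (`w₁ = Re w`). -/
local notation3 (prettyPrint := false) "wRe⟦" n "⟧" Q:max =>
  (fun S S' : Fin n → Fin (2 * n) => Complex.re ((wC⟦n⟧ Q) S S'))

/-- The skeleton's `weilClassIm n Q` (`w₂ = Im w`). -/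
local notation3 (prettyPrint := false) "wIm⟦" n "⟧" Q:max =>
  (fun S S' : Fin n → Fin (2 * n) => Complex.im ((wC⟦n⟧ Q) S S'))

/-! ## §1 The hermitian pairing `M̂ = dz ⊗ dz̄` on the three classes (general `n`) -/

section Hermitian

variable {n : ℕ}

/-- `conj (dz(S)) = det P̄[·, S]` with `P̄ = P.map conj`. [folklore] -/
theorem conj_dz_eq_det_submatrix (S : Fin n → Fin (2 * n)) :
    (starRingEnd ℂ) (dz⟦n⟧ S) = (((𝐏⟦n⟧).map (starRingEnd ℂ)).submatrix id S).det := by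
  rw [dz_eq_det_submatrix, RingHom.map_det, RingHom.mapMatrix_apply, ← Matrix.submatrix_map]

/-- `P̄ᵀ = Pᴴ`. [folklore] -/
theorem transpose_frame_map_conj : ((𝐏⟦n⟧).map (starRingEnd ℂ))ᵀ = (𝐏⟦n⟧)ᴴ := rfl

/-- **`M̂(cyc Z) = μ(Z) = Σ_σ w_σ a_σ |η_σ|²`** (Cauchy–Binet in each factor: `Σ_S dz(S) det L[S,·] = n! η`,
`Σ_{S'} conj dz(S') det L[S',·] = n! η̄`). [cite: MikhalkinZharkov2014Eigenwave, Prop. 4.3] -/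
theorem hermPairing_cyc (Q : Matrix (Fin (2 * n)) (Fin (2 * n)) ℝ) (Z : TropicalTorusCycle (2 * n) n Q) :
    M̂⟦n⟧ (TropicalTorusCycle.cyc Z) =
      ((∑ σ, ((Z.cell σ).weight : ℝ) * (Z.cell σ).latticeVolume *
        ‖frameComplexDet n (Z.cell σ).frame‖ ^ 2 : ℝ) : ℂ) := by
  have hF : (Nat.factorial n : ℂ) ≠ 0 := by exact_mod_cast Nat.factorial_ne_zero n
  have hconj : ∀ L : Matrix (Fin (2 * n)) (Fin n) ℤ,
      ∑ S' : Fin n → Fin (2 * n), (starRingEnd ℂ) (dz⟦n⟧ S') * ((pluckerCoord L S' : ℤ) : ℂ) =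
        (Nat.factorial n : ℂ) * (starRingEnd ℂ) (frameComplexDet n L) := by
    intro L
    have h := congrArg (starRingEnd ℂ) (sum_dz_mul_pluckerCoord L)
    rw [map_sum, map_mul, map_natCast] at h
    rw [← h]
    refine Finset.sum_congr rfl fun S' _ => ?_
    rw [map_mul, map_intCast]
  unfold TropicalTorusCycle.cyc
  calc ∑ S : Fin n → Fin (2 * n), ∑ S' : Fin n → Fin (2 * n),
        dz⟦n⟧ S * (starRingEnd ℂ) (dz⟦n⟧ S') / ((Nat.factorial n : ℂ) ^ 2) *
          (((fun S S' : Fin n → Fin (2 * n) => ∑ σ, ((Z.cell σ).weight : ℝ) * (Z.cell σ).latticeVolume *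
            ((pluckerCoord (Z.cell σ).frame S : ℤ) : ℝ) *
            ((pluckerCoord (Z.cell σ).frame S' : ℤ) : ℝ)) S S' : ℝ) : ℂ)
      = ∑ S : Fin n → Fin (2 * n), ∑ S' : Fin n → Fin (2 * n), ∑ σ,
          dz⟦n⟧ S * (starRingEnd ℂ) (dz⟦n⟧ S') / ((Nat.factorial n : ℂ) ^ 2) *
            (((Z.cell σ).weight : ℂ) * ((Z.cell σ).latticeVolume : ℂ) *
              ((pluckerCoord (Z.cell σ).frame S : ℤ) : ℂ) * ((pluckerCoord (Z.cell σ).frame S' : ℤ) : ℂ)) := by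
        refine Finset.sum_congr rfl fun S _ => Finset.sum_congr rfl fun S' _ => ?_
        beta_reduce
        rw [Complex.ofReal_sum, Finset.mul_sum]
        refine Finset.sum_congr rfl fun σ _ => ?_
        push_cast
        ring
    _ = ∑ σ, ∑ S : Fin n → Fin (2 * n), ∑ S' : Fin n → Fin (2 * n),
          dz⟦n⟧ S * (starRingEnd ℂ) (dz⟦n⟧ S') / ((Nat.factorial n : ℂ) ^ 2) *
            (((Z.cell σ).weight : ℂ) * ((Z.cell σ).latticeVolume : ℂ) *
              ((pluckerCoord (Z.cell σ).frame S : ℤ) : ℂ) * ((pluckerCoord (Z.cell σ).frame S' : ℤ) : ℂ)) := by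
        conv_lhs => enter [2, S]; rw [Finset.sum_comm]
        rw [Finset.sum_comm]
    _ = ∑ σ, ((Z.cell σ).weight : ℂ) * ((Z.cell σ).latticeVolume : ℂ) *
          (frameComplexDet n (Z.cell σ).frame * (starRingEnd ℂ) (frameComplexDet n (Z.cell σ).frame)) := by
        refine Finset.sum_congr rfl fun σ _ => ?_
        have key : ∑ S : Fin n → Fin (2 * n), ∑ S' : Fin n → Fin (2 * n),
            dz⟦n⟧ S * (starRingEnd ℂ) (dz⟦n⟧ S') / ((Nat.factorial n : ℂ) ^ 2) *
              (((Z.cell σ).weight : ℂ) * ((Z.cell σ).latticeVolume : ℂ) *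
                ((pluckerCoord (Z.cell σ).frame S : ℤ) : ℂ) *
                ((pluckerCoord (Z.cell σ).frame S' : ℤ) : ℂ)) =
            ((Z.cell σ).weight : ℂ) * ((Z.cell σ).latticeVolume : ℂ) / ((Nat.factorial n : ℂ) ^ 2) *
              ((∑ S : Fin n → Fin (2 * n), dz⟦n⟧ S * ((pluckerCoord (Z.cell σ).frame S : ℤ) : ℂ)) *
               (∑ S' : Fin n → Fin (2 * n),
                  (starRingEnd ℂ) (dz⟦n⟧ S') * ((pluckerCoord (Z.cell σ).frame S' : ℤ) : ℂ))) := by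
          rw [Finset.sum_mul_sum, Finset.mul_sum]
          refine Finset.sum_congr rfl fun S _ => ?_
          rw [Finset.mul_sum]
          refine Finset.sum_congr rfl fun S' _ => ?_
          ring
        rw [key, sum_dz_mul_pluckerCoord, hconj]
        field_simp
    _ = ((∑ σ, ((Z.cell σ).weight : ℝ) * (Z.cell σ).latticeVolume *
          ‖frameComplexDet n (Z.cell σ).frame‖ ^ 2 : ℝ) : ℂ) := by
        rw [Complex.ofReal_sum]
        refine Finset.sum_congr rfl fun σ _ => ?_
        rw [Complex.mul_conj, Complex.normSq_eq_norm_sq]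
        push_cast
        ring

/-- **`M̂(θ_n(Q)) = det (P Q Pᴴ)`** (all-maps Cauchy–Binet twice, `P̄ᵀ = Pᴴ`).
[cite: Zharkov2020TropicalWeil, §2] -/
theorem hermPairing_thetaClass_eq_det (Q : Matrix (Fin (2 * n)) (Fin (2 * n)) ℝ) :
    M̂⟦n⟧ (θ⟦n⟧ Q) = (𝐏⟦n⟧ * Q.map ((↑) : ℝ → ℂ) * (𝐏⟦n⟧)ᴴ).det := by
  have hF : (Nat.factorial n : ℂ) ≠ 0 := by exact_mod_cast Nat.factorial_ne_zero n
  calc M̂⟦n⟧ (θ⟦n⟧ Q)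
      = (∑ S : Fin n → Fin (2 * n), ∑ S' : Fin n → Fin (2 * n),
          ((𝐏⟦n⟧).submatrix id S).det * ((((𝐏⟦n⟧).map (starRingEnd ℂ))).submatrix id S').det *
            ((Q.map ((↑) : ℝ → ℂ)).submatrix S S').det) / ((Nat.factorial n : ℂ) ^ 2) := by
        rw [Finset.sum_div]
        refine Finset.sum_congr rfl fun S _ => ?_
        rw [Finset.sum_div]
        refine Finset.sum_congr rfl fun S' _ => ?_
        beta_reduce
        rw [conj_dz_eq_det_submatrix, dz_eq_det_submatrix, ofReal_det, ← Matrix.submatrix_map]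
        ring
    _ = (𝐏⟦n⟧ * Q.map ((↑) : ℝ → ℂ) * (𝐏⟦n⟧)ᴴ).det := by
        rw [sum_sum_det_mul_det_mul_det_submatrix, transpose_frame_map_conj,
          mul_div_cancel_left₀ _ (pow_ne_zero 2 hF)]

/-- `P̄ Pᴴ = conj (P Pᵀ) = 0`. [folklore] -/
theorem frame_map_conj_mul_frame_conjTranspose :
    (𝐏⟦n⟧).map (starRingEnd ℂ) * (𝐏⟦n⟧)ᴴ = 0 := by
  have h : (𝐏⟦n⟧ * (𝐏⟦n⟧)ᵀ).map (starRingEnd ℂ) = 0 := by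
    rw [frame_mul_frame_transpose, Matrix.map_zero _ (map_zero _)]
  rw [Matrix.map_mul] at h
  rw [← transpose_frame_map_conj, ← Matrix.transpose_map]
  exact h

/-- **`M̂_ℂ(w(Q)) = 0`**: in product form the second factor is `n! det (P̄ Pᴴ) = 0` (`n ≥ 1`).
[cite: Zharkov2020TropicalWeil, §2] -/
theorem hermPairingC_weilClassC_eq_zero (hn : 0 < n) (Q : Matrix (Fin (2 * n)) (Fin (2 * n)) ℝ) :
    ∑ S : Fin n → Fin (2 * n), ∑ S' : Fin n → Fin (2 * n),
        dz⟦n⟧ S * (starRingEnd ℂ) (dz⟦n⟧ S') / ((Nat.factorial n : ℂ) ^ 2) * ((wC⟦n⟧ Q) S S') = 0 := by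
  haveI : Nonempty (Fin n) := ⟨⟨0, hn⟩⟩
  beta_reduce
  simp only [conj_dz_eq_det_submatrix]
  simp only [← frame_conjTranspose_eq, dz_eq_det_submatrix]
  calc ∑ S : Fin n → Fin (2 * n), ∑ S' : Fin n → Fin (2 * n),
        ((𝐏⟦n⟧).submatrix id S).det * (((𝐏⟦n⟧).map (starRingEnd ℂ)).submatrix id S').det /
            ((Nat.factorial n : ℂ) ^ 2) *
          (((Q.map ((↑) : ℝ → ℂ) * (𝐏⟦n⟧)ᴴ).submatrix S id).det * (((𝐏⟦n⟧)ᴴ).submatrix S' id).det)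
      = (∑ S : Fin n → Fin (2 * n), ∑ S' : Fin n → Fin (2 * n),
          ((𝐏⟦n⟧).submatrix id S).det * (((𝐏⟦n⟧).map (starRingEnd ℂ)).submatrix id S').det *
          (((Q.map ((↑) : ℝ → ℂ) * (𝐏⟦n⟧)ᴴ).submatrix S id).det * (((𝐏⟦n⟧)ᴴ).submatrix S' id).det)) /
          ((Nat.factorial n : ℂ) ^ 2) := by
        rw [Finset.sum_div]
        refine Finset.sum_congr rfl fun S _ => ?_
        rw [Finset.sum_div]
        refine Finset.sum_congr rfl fun S' _ => ?_
        ring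
    _ = 0 := by
        rw [sum_sum_det_mul_det_mul_det_mul_det, frame_map_conj_mul_frame_conjTranspose, Matrix.det_zero]
        simp

/-- **`M̂_ℂ(w̄(Q)) = 0` for `QJ = JQ`**: in product form the first factor is `n! det (P Q Pᵀ) = 0`
(`n ≥ 1`). [cite: Zharkov2020TropicalWeil, §2] -/
theorem hermPairingC_conj_weilClassC_eq_zero (hn : 0 < n) (Q : Matrix (Fin (2 * n)) (Fin (2 * n)) ℝ)
    (hJ : Q * weilJ n = weilJ n * Q) :
    ∑ S : Fin n → Fin (2 * n), ∑ S' : Fin n → Fin (2 * n),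
        dz⟦n⟧ S * (starRingEnd ℂ) (dz⟦n⟧ S') / ((Nat.factorial n : ℂ) ^ 2) *
          (starRingEnd ℂ) ((wC⟦n⟧ Q) S S') = 0 := by
  haveI : Nonempty (Fin n) := ⟨⟨0, hn⟩⟩
  beta_reduce
  simp only [conj_dz_eq_det_submatrix]
  simp only [← frame_conjTranspose_eq, dz_eq_det_submatrix, map_mul,
    RingHom.map_det, RingHom.mapMatrix_apply, ← Matrix.submatrix_map, Matrix.map_mul, map_ofReal_map_conj,
    frame_conjTranspose_map_conj]
  calc ∑ S : Fin n → Fin (2 * n), ∑ S' : Fin n → Fin (2 * n),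
        ((𝐏⟦n⟧).submatrix id S).det * (((𝐏⟦n⟧).map (starRingEnd ℂ)).submatrix id S').det /
            ((Nat.factorial n : ℂ) ^ 2) *
          (((Q.map ((↑) : ℝ → ℂ) * (𝐏⟦n⟧)ᵀ).submatrix S id).det * (((𝐏⟦n⟧)ᵀ).submatrix S' id).det)
      = (∑ S : Fin n → Fin (2 * n), ∑ S' : Fin n → Fin (2 * n),
          ((𝐏⟦n⟧).submatrix id S).det * (((𝐏⟦n⟧).map (starRingEnd ℂ)).submatrix id S').det *
          (((Q.map ((↑) : ℝ → ℂ) * (𝐏⟦n⟧)ᵀ).submatrix S id).det * (((𝐏⟦n⟧)ᵀ).submatrix S' id).det)) /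
          ((Nat.factorial n : ℂ) ^ 2) := by
        rw [Finset.sum_div]
        refine Finset.sum_congr rfl fun S _ => ?_
        rw [Finset.sum_div]
        refine Finset.sum_congr rfl fun S' _ => ?_
        ring
    _ = 0 := by
        rw [sum_sum_det_mul_det_mul_det_mul_det, ← Matrix.mul_assoc,
          frame_mul_map_mul_frame_transpose_eq_zero Q hJ, Matrix.det_zero]
        simp

/-- **`M̂(Re w(Q)) = 0` for `QJ = JQ`, `n ≥ 1`** (`2 M̂(Re w) = M̂_ℂ(w) + M̂_ℂ(w̄) = 0`).
[cite: Zharkov2020TropicalWeil, §2] -/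
theorem hermPairing_weilClassRe_eq_zero (hn : 0 < n) (Q : Matrix (Fin (2 * n)) (Fin (2 * n)) ℝ)
    (hJ : Q * weilJ n = weilJ n * Q) : M̂⟦n⟧ (wRe⟦n⟧ Q) = 0 := by
  have hA := sum_sum_mul_re_add_I_mul
    (fun S S' : Fin n → Fin (2 * n) => dz⟦n⟧ S * (starRingEnd ℂ) (dz⟦n⟧ S') / ((Nat.factorial n : ℂ) ^ 2))
    (wC⟦n⟧ Q)
  have hB := sum_sum_mul_re_sub_I_mul
    (fun S S' : Fin n → Fin (2 * n) => dz⟦n⟧ S * (starRingEnd ℂ) (dz⟦n⟧ S') / ((Nat.factorial n : ℂ) ^ 2))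
    (wC⟦n⟧ Q)
  beta_reduce at hA hB
  rw [hermPairingC_weilClassC_eq_zero hn Q] at hA
  rw [hermPairingC_conj_weilClassC_eq_zero hn Q hJ] at hB
  beta_reduce
  linear_combination (hA + hB) / 2

/-- **`M̂(Im w(Q)) = 0` for `QJ = JQ`, `n ≥ 1`** (`2i M̂(Im w) = M̂_ℂ(w) - M̂_ℂ(w̄) = 0`).
[cite: Zharkov2020TropicalWeil, §2] -/
theorem hermPairing_weilClassIm_eq_zero (hn : 0 < n) (Q : Matrix (Fin (2 * n)) (Fin (2 * n)) ℝ)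
    (hJ : Q * weilJ n = weilJ n * Q) : M̂⟦n⟧ (wIm⟦n⟧ Q) = 0 := by
  have hA := sum_sum_mul_re_add_I_mul
    (fun S S' : Fin n → Fin (2 * n) => dz⟦n⟧ S * (starRingEnd ℂ) (dz⟦n⟧ S') / ((Nat.factorial n : ℂ) ^ 2))
    (wC⟦n⟧ Q)
  have hB := sum_sum_mul_re_sub_I_mul
    (fun S S' : Fin n → Fin (2 * n) => dz⟦n⟧ S * (starRingEnd ℂ) (dz⟦n⟧ S') / ((Nat.factorial n : ℂ) ^ 2))
    (wC⟦n⟧ Q)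
  beta_reduce at hA hB
  rw [hermPairingC_weilClassC_eq_zero hn Q] at hA
  rw [hermPairingC_conj_weilClassC_eq_zero hn Q hJ] at hB
  beta_reduce
  have hI : Complex.I ≠ 0 := Complex.I_ne_zero
  have h2 : (2 : ℂ) * Complex.I * (∑ S : Fin n → Fin (2 * n), ∑ S' : Fin n → Fin (2 * n),
      dz⟦n⟧ S * (starRingEnd ℂ) (dz⟦n⟧ S') / ((Nat.factorial n : ℂ) ^ 2) *
        ((((wC⟦n⟧ Q) S S').im : ℝ) : ℂ)) = 0 := by
    linear_combination hA - hB
  simpa [hI] using h2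

/-- **The values of `Ŵ` on the real Weil classes:** `Ŵ(Re w(Q)) = 2ⁿ⁻¹ det (P Q Pᴴ)` (`n ≥ 1`).
[cite: Zharkov2020TropicalWeil, §2] -/
theorem weilPairing_weilClassRe_eq (hn : 0 < n) (Q : Matrix (Fin (2 * n)) (Fin (2 * n)) ℝ) :
    Ŵ⟦n⟧ (wRe⟦n⟧ Q) = (2 : ℂ) ^ (n - 1) * (𝐏⟦n⟧ * Q.map ((↑) : ℝ → ℂ) * (𝐏⟦n⟧)ᴴ).det := by
  have hA := sum_sum_mul_re_add_I_mul
    (fun S S' : Fin n → Fin (2 * n) => dz⟦n⟧ S * dz⟦n⟧ S' / ((Nat.factorial n : ℂ) ^ 2)) (wC⟦n⟧ Q)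
  have hB := sum_sum_mul_re_sub_I_mul
    (fun S S' : Fin n → Fin (2 * n) => dz⟦n⟧ S * dz⟦n⟧ S' / ((Nat.factorial n : ℂ) ^ 2)) (wC⟦n⟧ Q)
  beta_reduce at hA hB
  rw [weilPairingC_weilClassC_eq Q] at hA
  rw [weilPairingC_conj_weilClassC_eq_zero hn Q] at hB
  beta_reduce
  have h2n : (2 : ℂ) ^ n = 2 * 2 ^ (n - 1) := by
    rw [← pow_succ']; congr 1; omega
  linear_combination (hA + hB) / 2 + (𝐏⟦n⟧ * Q.map ((↑) : ℝ → ℂ) * (𝐏⟦n⟧)ᴴ).det * h2n / 2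

/-- **`Ŵ(Im w(Q)) = -i · 2ⁿ⁻¹ det (P Q Pᴴ)`** (`n ≥ 1`). [cite: Zharkov2020TropicalWeil, §2] -/
theorem weilPairing_weilClassIm_eq (hn : 0 < n) (Q : Matrix (Fin (2 * n)) (Fin (2 * n)) ℝ) :
    Ŵ⟦n⟧ (wIm⟦n⟧ Q) =
      -Complex.I * (2 : ℂ) ^ (n - 1) * (𝐏⟦n⟧ * Q.map ((↑) : ℝ → ℂ) * (𝐏⟦n⟧)ᴴ).det := by
  have hA := sum_sum_mul_re_add_I_mul
    (fun S S' : Fin n → Fin (2 * n) => dz⟦n⟧ S * dz⟦n⟧ S' / ((Nat.factorial n : ℂ) ^ 2)) (wC⟦n⟧ Q)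
  have hB := sum_sum_mul_re_sub_I_mul
    (fun S S' : Fin n → Fin (2 * n) => dz⟦n⟧ S * dz⟦n⟧ S' / ((Nat.factorial n : ℂ) ^ 2)) (wC⟦n⟧ Q)
  beta_reduce at hA hB
  rw [weilPairingC_weilClassC_eq Q] at hA
  rw [weilPairingC_conj_weilClassC_eq_zero hn Q] at hB
  beta_reduce
  have h2n : (2 : ℂ) ^ n = 2 * 2 ^ (n - 1) := by
    rw [← pow_succ']; congr 1; omega
  apply mul_left_cancel₀ (show (2 : ℂ) * Complex.I ≠ 0 by simp [Complex.I_ne_zero])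
  linear_combination hA - hB + (𝐏⟦n⟧ * Q.map ((↑) : ℝ → ℂ) * (𝐏⟦n⟧)ᴴ).det * h2n +
    (2 * 2 ^ (n - 1) * (𝐏⟦n⟧ * Q.map ((↑) : ℝ → ℂ) * (𝐏⟦n⟧)ᴴ).det) * Complex.I_mul_I

/-- `v ↦ v P` is injective (`(v P)_k = v_k` for `k < n`). [folklore] -/
theorem vecMul_frame_injective : Function.Injective fun v : Fin n → ℂ => v ᵥ* 𝐏⟦n⟧ := by
  intro v w h
  funext k
  have hk := congrFun h ⟨(k : ℕ), by omega⟩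
  have hn0 : ¬ (n = 0) := by have := k.2; omega
  have key : ∀ u : Fin n → ℂ, (u ᵥ* 𝐏⟦n⟧) ⟨(k : ℕ), by omega⟩ = u k := by
    intro u
    rw [Matrix.vecMul, dotProduct]
    rw [Finset.sum_eq_single k]
    · simp [Matrix.of_apply, hn0]
    · intro b _ hb
      have hb' : ¬ ((k : ℕ) = (b : ℕ)) := fun e => hb (Fin.ext e.symm)
      simp only [Matrix.of_apply]
      rw [if_neg hb', if_neg (by omega)]
      simp
    · intro hk'; exact absurd (Finset.mem_univ _) hk'
  simpa [key] using hk

/-- **`det (P Q Pᴴ)` is a positive real for `Q ≻ 0`** (`P Q Pᴴ` is the positive definite hermitian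
form of `Q` on `V^{1,0}`). [cite: Zharkov2020TropicalWeil, §2] -/
theorem det_frame_mul_map_mul_conjTranspose_pos (Q : Matrix (Fin (2 * n)) (Fin (2 * n)) ℝ)
    (hQ : Q.PosDef) :
    0 < ((𝐏⟦n⟧ * Q.map ((↑) : ℝ → ℂ) * (𝐏⟦n⟧)ᴴ).det).re ∧
      ((𝐏⟦n⟧ * Q.map ((↑) : ℝ → ℂ) * (𝐏⟦n⟧)ᴴ).det).im = 0 := by
  have hQc : (Q.map ((↑) : ℝ → ℂ)).PosDef :=
    Literature.Geometry.Kaehler.ComplexTorus.posDef_map_ofRealHom hQ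
  have hP : (𝐏⟦n⟧ * Q.map ((↑) : ℝ → ℂ) * (𝐏⟦n⟧)ᴴ).PosDef :=
    hQc.mul_mul_conjTranspose_same vecMul_frame_injective
  have hdet := hP.det_pos
  exact ⟨(RCLike.pos_iff.mp hdet).1, (RCLike.pos_iff.mp hdet).2⟩

end Hermitian

end Summit.HodgeConjecture.HodgeConjecture.Theorems.TropicalHodgeBound

end
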